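import Summits.AnomalousDissipation.AnomalousDissipation.Theorems.SoloBlindSweptScreening
import Summits.AnomalousDissipation.AnomalousDissipation.Theorems.SoloBlindSweptBeltrami

/-!
# Non-resonant screening for arbitrary mode sets, and the Beltrami Leray–Hopf families
  (solo soloist, blind mode)

`SoloBlindSweptBeltramiScreening` — the energy and dissipation bounds of `SoloBlindSweptScreening`
freed from the unidirectional hypothesis: for ANY finite symmetric mode set `S ∌ 0` and any
momentum `c` that is **non-resonant** on `S`, `|c·k| ≥ δ > 0` for `k ∈ S`, the swept state
`U_{ν,c} = sweptState ν c S C` of the force `f = realTrigPoly S C` satisfies, uniformly in `ν ≥ 0`,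

  `∫‖U_{ν,c}‖² ≤ ‖c‖² + ‖f‖₂²/(2πδ)²`,  `ν‖∇U_{ν,c}‖² ≤ ν · K‖f‖₂²/δ²`  (`|k|² ≤ K` on `S`)

(`integral_norm_sq_sweptState_le_of_nonres`, `dissipation_sweptState_le_of_nonres`, from
`|σ(k)|² ≥ 4π²δ²`, `norm_sq_sweptSymbol_ge_of_nonres`). Whenever the swept states are steady
states of `NS_ν(f)` for all `ν > 0` (a hypothesis here; proved for unidirectional forces in
`SoloBlindSweptStates` and for Beltrami-wave forces in `SoloBlindSweptBeltrami`), they furnish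
global Leray–Hopf families at `νⱼ = 1/(j+1) → 0` with every clause of `Literature.Turb.ZerothLaw`
but the dissipation floor: bounded mean energy, mean dissipation `≤ Kνⱼ → 0`, momentum `c`
(`exists_sweptFamily_of_nonres`).

**The Beltrami families** (`exists_sweptFamily_beltrami`): for every `n ≠ 0`, every amplitude
family with the reality condition and every momentum `c` with `|c·λξ| ≥ δ > 0` on `Λ`, the swept
Beltrami states are such a family for the genuinely three-dimensional force
`W = beltramiField n a` (`|k|² = 25n²` on `λΛ`, `freqNormSq_kvec`).
[cite: LuoTiti2020, §3.2 Prop. 1] [cite: Frisch1995, §5.2] [cite: DoeringFoias2002, §2]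
-/

open MeasureTheory Filter Topology Set UnitAddTorus
open scoped ENNReal NNReal ComplexConjugate InnerProductSpace

noncomputable section

namespace Summit.AnomalousDissipation.AnomalousDissipation.Theorems

open Literature.Analysis.FunctionSpaces Literature.Analysis.FunctionSpaces.Torus
open Literature.Analysis.FluidPDE Literature.Analysis.FluidPDE.IntermittentBeltrami

/-! ### Non-resonant screening on an arbitrary finite mode set -/

/-- **Non-resonance bounds the swept symbol from below, uniformly in `ν`**:
`|c·k| ≥ δ ≥ 0` on `S` gives `|σ(k)|² ≥ (2πδ)²` on `S`. [folklore] -/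
theorem norm_sq_sweptSymbol_ge_of_nonres {ν : ℝ} {c : EuclideanSpace ℝ (Fin 3)}
    {S : Finset (Fin 3 → ℤ)} {δ : ℝ} (hδ0 : 0 ≤ δ) (hδ : ∀ k ∈ S, δ ≤ |freqDot c k|)
    {k : Fin 3 → ℤ} (hk : k ∈ S) : (2 * Real.pi * δ) ^ 2 ≤ ‖sweptSymbol ν c k‖ ^ 2 := by
  rw [norm_sq_sweptSymbol]
  have h1 : δ ^ 2 ≤ freqDot c k ^ 2 := by
    rw [← sq_abs (freqDot c k)]
    exact pow_le_pow_left₀ hδ0 (hδ k hk) 2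
  nlinarith [sq_nonneg (4 * Real.pi ^ 2 * ν * freqNormSq k),
    mul_le_mul_of_nonneg_left h1 (by positivity : (0 : ℝ) ≤ 4 * Real.pi ^ 2)]

/-- **Energy bound, uniform in the viscosity, on a non-resonant momentum leaf**:
`∫‖U_{ν,c}‖² ≤ ‖c‖² + ‖f‖₂²/(2πδ)²`. [folklore] -/
theorem integral_norm_sq_sweptState_le_of_nonres (ν : ℝ) {c : EuclideanSpace ℝ (Fin 3)}
    {S : Finset (Fin 3 → ℤ)} (hS : ∀ k ∈ S, -k ∈ S) (h0 : (0 : Fin 3 → ℤ) ∉ S)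
    {C : (Fin 3 → ℤ) → EuclideanSpace ℂ (Fin 3)} (hC : IsConjSymm C) {δ : ℝ} (hδ0 : 0 < δ)
    (hδ : ∀ k ∈ S, δ ≤ |freqDot c k|) :
    ∫ x, ‖sweptState ν c S C x‖ ^ 2 ≤
      ‖c‖ ^ 2 + (∫ x, ‖realTrigPoly S C x‖ ^ 2) / (2 * Real.pi * δ) ^ 2 := by
  rw [integral_norm_sq_sweptState ν c hS h0 hC, integral_norm_sq_realTrigPoly hS hC, Finset.sum_div]
  refine add_le_add le_rfl (Finset.sum_le_sum fun k hk => ?_)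
  have hpos : 0 < (2 * Real.pi * δ) ^ 2 := by positivity
  have h1 := norm_sq_sweptSymbol_ge_of_nonres (ν := ν) hδ0.le hδ hk
  rw [div_le_div_iff₀ (lt_of_lt_of_le hpos h1) hpos]
  nlinarith [mul_le_mul_of_nonneg_left h1 (sq_nonneg ‖C k‖)]

/-- **Dissipation bound, linear in the viscosity, on a non-resonant momentum leaf**:
`ν‖∇U_{ν,c}‖² ≤ ν · K‖f‖₂²/δ²` if `|k|² ≤ K` on `S`. [folklore] -/
theorem dissipation_sweptState_le_of_nonres {ν : ℝ} (hν : 0 ≤ ν) {c : EuclideanSpace ℝ (Fin 3)}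
    {S : Finset (Fin 3 → ℤ)} (hS : ∀ k ∈ S, -k ∈ S) (h0 : (0 : Fin 3 → ℤ) ∉ S)
    {C : (Fin 3 → ℤ) → EuclideanSpace ℂ (Fin 3)} (hC : IsConjSymm C) {δ : ℝ} (hδ0 : 0 < δ)
    (hδ : ∀ k ∈ S, δ ≤ |freqDot c k|) {K : ℝ} (hK : ∀ k ∈ S, freqNormSq k ≤ K) :
    ν * (eGradNormSq (sweptState ν c S C)).toReal ≤
      ν * (K * (∫ x, ‖realTrigPoly S C x‖ ^ 2) / δ ^ 2) := by
  rw [dissipation_sweptState ν c hS h0 hC, integral_norm_sq_realTrigPoly hS hC]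
  have hpos : 0 < δ ^ 2 := by positivity
  calc 4 * Real.pi ^ 2 * ν * ∑ k ∈ S, freqNormSq k * ‖C k‖ ^ 2 / ‖sweptSymbol ν c k‖ ^ 2
      = ∑ k ∈ S, ν * (4 * Real.pi ^ 2 * freqNormSq k * ‖C k‖ ^ 2 / ‖sweptSymbol ν c k‖ ^ 2) := by
        rw [Finset.mul_sum]
        exact Finset.sum_congr rfl fun k _ => by ring
    _ ≤ ∑ k ∈ S, ν * (K * ‖C k‖ ^ 2 / δ ^ 2) :=
        Finset.sum_le_sum fun k hk => mul_le_mul_of_nonneg_left (by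
          have h1 := norm_sq_sweptSymbol_ge_of_nonres (ν := ν) hδ0.le hδ hk
          have hσ : 0 < ‖sweptSymbol ν c k‖ ^ 2 := lt_of_lt_of_le (by positivity) h1
          rw [div_le_div_iff₀ hσ hpos]
          have h3 := mul_le_mul_of_nonneg_right (hK k hk) (sq_nonneg ‖C k‖)
          nlinarith [mul_le_mul h3 h1 (by positivity) (by nlinarith [freqNormSq_nonneg k]),
            Real.pi_pos]) hν
    _ = ν * (K * (∑ k ∈ S, ‖C k‖ ^ 2) / δ ^ 2) := by
        rw [← Finset.mul_sum]
        congr 1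
        rw [Finset.mul_sum, Finset.sum_div]

/-- **Separating Leray–Hopf families on every non-resonant momentum leaf.** If the swept states
of `f = realTrigPoly S C` are steady states of `NS_ν(f)` for all `ν > 0` (true for unidirectional
and for Beltrami-wave forces), then at `νⱼ = 1/(j+1)` they are global Leray–Hopf solutions of
momentum `c` with uniformly bounded mean energy and mean dissipation `≤ Kνⱼ → 0`: every clause
of `Literature.Turb.ZerothLaw` but the floor. [folklore] -/
theorem exists_sweptFamily_of_nonres {S : Finset (Fin 3 → ℤ)} (hS : ∀ k ∈ S, -k ∈ S)
    (h0 : (0 : Fin 3 → ℤ) ∉ S) {C : (Fin 3 → ℤ) → EuclideanSpace ℂ (Fin 3)} (hC : IsConjSymm C)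
    {c : EuclideanSpace ℝ (Fin 3)} {δ : ℝ} (hδ0 : 0 < δ) (hδ : ∀ k ∈ S, δ ≤ |freqDot c k|)
    {K : ℝ} (hK : ∀ k ∈ S, freqNormSq k ≤ K) {p : ℝ → UnitAddTorus (Fin 3) → ℝ}
    (hsteady : ∀ ν, 0 < ν → Torus.IsSteadyNSState ν (realTrigPoly S C) (sweptState ν c S C) (p ν)) :
    ∃ (ν : ℕ → ℝ) (u : ℕ → ℝ → UnitAddTorus (Fin 3) → EuclideanSpace ℝ (Fin 3)),
      (∀ j, 0 < ν j) ∧ Tendsto ν atTop (𝓝 0) ∧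
      (∀ j, Torus.IsGlobalLerayHopf (ν j) (fun _ => realTrigPoly S C) (u j 0) (u j)) ∧
      (∀ j, meanEnergy (u j) ≤
        ‖c‖ ^ 2 + (∫ x, ‖realTrigPoly S C x‖ ^ 2) / (2 * Real.pi * δ) ^ 2) ∧
      (∀ j, meanDissipation (ν j) (u j) ≤
        ν j * (K * (∫ x, ‖realTrigPoly S C x‖ ^ 2) / δ ^ 2)) ∧
      Tendsto (fun j => meanDissipation (ν j) (u j)) atTop (𝓝 0) ∧
      (∀ j t, ∫ x, u j t x = c) := by
  have hν : ∀ j : ℕ, (0 : ℝ) < 1 / ((j : ℝ) + 1) := fun j => by positivity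
  set K' : ℝ := K * (∫ x, ‖realTrigPoly S C x‖ ^ 2) / δ ^ 2 with hK'
  have hE : ∀ ν, meanEnergy (fun _ : ℝ => sweptState ν c S C) = ∫ x, ‖sweptState ν c S C x‖ ^ 2 :=
    fun ν => by rw [meanEnergy_eq_longTimeAvgSup]; exact longTimeAvgSup_of_eq_const fun _ _ => rfl
  have hD : ∀ ν, meanDissipation ν (fun _ : ℝ => sweptState ν c S C) =
      ν * (eGradNormSq (sweptState ν c S C)).toReal := fun ν => by
    unfold meanDissipation; exact longTimeAvgSup_of_eq_const fun _ _ => rfl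
  refine ⟨fun j => 1 / ((j : ℝ) + 1), fun j _ => sweptState (1 / ((j : ℝ) + 1)) c S C, hν,
    tendsto_one_div_add_atTop_nhds_zero_nat,
    fun j => IsClassicalNSSolutionOn.isGlobalLerayHopf (hsteady _ (hν j)),
    fun j => ?_, fun j => ?_, ?_, fun j _ => integral_sweptState _ c h0 C⟩
  · rw [hE]; exact integral_norm_sq_sweptState_le_of_nonres _ hS h0 hC hδ0 hδ
  · rw [hD]; exact dissipation_sweptState_le_of_nonres (hν j).le hS h0 hC hδ0 hδ hK
  · have hK0 : Tendsto (fun j : ℕ => 1 / ((j : ℝ) + 1) * K') atTop (𝓝 0) := by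
      simpa using tendsto_one_div_add_atTop_nhds_zero_nat.mul_const K'
    refine squeeze_zero (fun j => ?_) (fun j => ?_) hK0
    · rw [hD]; exact mul_nonneg (hν j).le ENNReal.toReal_nonneg
    · rw [hD]; exact dissipation_sweptState_le_of_nonres (hν j).le hS h0 hC hδ0 hδ hK

/-! ### The Beltrami families -/

/-- `|λξ|² = 25n²` on `Λ` (`|ξ| = 1`, `λ = 5n`). [folklore] -/
theorem freqNormSq_kvec (n : ℤ) (y : LIndex) : freqNormSq (kvec n y) = 25 * (n : ℝ) ^ 2 := by
  simp only [freqNormSq, kvec_cast]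
  have h := sum_dir_sq y
  calc ∑ i, (5 * (n : ℝ) * dir y i) ^ 2 = 25 * (n : ℝ) ^ 2 * ∑ i, dir y i * dir y i := by
        rw [Finset.mul_sum]; exact Finset.sum_congr rfl fun i _ => by ring
    _ = 25 * (n : ℝ) ^ 2 := by rw [h, mul_one]

/-- **The Beltrami Leray–Hopf families.** For every `n ≠ 0`, every amplitude family `a` with the
reality condition and every momentum `c` non-resonant on `λΛ` (`|c·λξ| ≥ δ > 0`), the swept
Beltrami states of the three-dimensional force `W = beltramiField n a` at `νⱼ = 1/(j+1) → 0` are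
global Leray–Hopf solutions of `NS_{νⱼ}(W)` of momentum `c`, with mean energy
`≤ ‖c‖² + ‖W‖₂²/(2πδ)²` for all `j` and mean dissipation `≤ νⱼ · 25n²‖W‖₂²/δ² → 0`.
[cite: LuoTiti2020, §3.2 Prop. 1] -/
theorem exists_sweptFamily_beltrami {n : ℤ} (hn : n ≠ 0) {a : LIndex → ℂ} (ha : IsCoefSymm a)
    {c : EuclideanSpace ℝ (Fin 3)} {δ : ℝ} (hδ0 : 0 < δ)
    (hδ : ∀ y : LIndex, δ ≤ |freqDot c (kvec n y)|) :
    ∃ (ν : ℕ → ℝ) (u : ℕ → ℝ → UnitAddTorus (Fin 3) → EuclideanSpace ℝ (Fin 3)),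
      (∀ j, 0 < ν j) ∧ Tendsto ν atTop (𝓝 0) ∧
      (∀ j, Torus.IsGlobalLerayHopf (ν j) (fun _ => beltramiField n a) (u j 0) (u j)) ∧
      (∀ j, meanEnergy (u j) ≤
        ‖c‖ ^ 2 + (∫ x, ‖beltramiField n a x‖ ^ 2) / (2 * Real.pi * δ) ^ 2) ∧
      (∀ j, meanDissipation (ν j) (u j) ≤
        ν j * (25 * (n : ℝ) ^ 2 * (∫ x, ‖beltramiField n a x‖ ^ 2) / δ ^ 2)) ∧
      Tendsto (fun j => meanDissipation (ν j) (u j)) atTop (𝓝 0) ∧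
      (∀ j t, ∫ x, u j t x = c) := by
  have hW : beltramiField n a = realTrigPoly (freqSet n) (coef n a) := rfl
  have hδ' : ∀ k ∈ freqSet n, δ ≤ |freqDot c k| := fun k hk => by
    obtain ⟨y, -, rfl⟩ := Finset.mem_image.mp hk
    exact hδ y
  have hK : ∀ k ∈ freqSet n, freqNormSq k ≤ 25 * (n : ℝ) ^ 2 := fun k hk => by
    obtain ⟨y, -, rfl⟩ := Finset.mem_image.mp hk
    exact (freqNormSq_kvec n y).le
  have hσ : ∀ ν, ∀ k ∈ freqSet n, sweptSymbol ν c k ≠ 0 := fun ν k hk =>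
    sweptSymbol_ne_zero (Or.inr fun h => by
      have := hδ' k hk
      rw [h, abs_zero] at this
      exact absurd this (not_le.mpr hδ0))
  have hsteady : ∀ ν : ℝ, 0 < ν → Torus.IsSteadyNSState ν (realTrigPoly (freqSet n) (coef n a))
      (sweptState ν c (freqSet n) (coef n a))
      (fun y => (-(1 / 2) : ℝ) * ‖beltramiField n (sweptAmp ν c n a) y‖ ^ 2) :=
    fun ν _ => isSteadyNSState_sweptState_beltrami hn (hσ ν)
  have main := exists_sweptFamily_of_nonres (fun k hk => neg_mem_freqSet hk)
    (zero_not_mem_freqSet hn) (isConjSymm_coef ha n) hδ0 hδ' hK hsteady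
  rw [hW]
  exact main

/-! ### Non-vacuity: a concrete non-resonant momentum for the first shell -/

/-- The momentum `c₀ = (1, 10, 100)` is non-resonant on the first Beltrami shell `5Λ`
(`k ∈ {(±3,±4,0), (0,±3,±4), (±4,0,±3)}` up to sign): `|c₀·k| ≥ 37`. [folklore] -/
theorem freqDot_kvec_one_ge (y : LIndex) :
    (37 : ℝ) ≤ |freqDot !₂[(1 : ℝ), 10, 100] (kvec 1 y)| := by
  obtain ⟨⟨i, b⟩, b'⟩ := y
  fin_cases i <;> cases b <;> cases b' <;>
    norm_num [freqDot, kvec, intDir, intDirPlus, four, Fin.sum_univ_three, Matrix.cons_val_two,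
      Matrix.head_cons, Matrix.tail_cons]

/-- **The Beltrami class is non-empty in every clause**: for the unit-amplitude first-shell
Beltrami wave `W = beltramiField 1 1` and the momentum `c₀ = (1, 10, 100)` there is a global
Leray–Hopf family of `NS_{νⱼ}(W)`, `νⱼ → 0`, with mean energy `≤ ‖c₀‖² + ‖W‖₂²/(74π)²`, mean
dissipation `≤ 25νⱼ‖W‖₂²/37² → 0` and momentum `c₀`. [folklore] -/
theorem exists_sweptFamily_beltrami_one :
    ∃ (ν : ℕ → ℝ) (u : ℕ → ℝ → UnitAddTorus (Fin 3) → EuclideanSpace ℝ (Fin 3)),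
      (∀ j, 0 < ν j) ∧ Tendsto ν atTop (𝓝 0) ∧
      (∀ j, Torus.IsGlobalLerayHopf (ν j) (fun _ => beltramiField 1 (fun _ => 1)) (u j 0) (u j)) ∧
      (∀ j, meanEnergy (u j) ≤ ‖(!₂[(1 : ℝ), 10, 100] : EuclideanSpace ℝ (Fin 3))‖ ^ 2 +
        (∫ x, ‖beltramiField 1 (fun _ => 1) x‖ ^ 2) / (2 * Real.pi * 37) ^ 2) ∧
      (∀ j, meanDissipation (ν j) (u j) ≤
        ν j * (25 * ((1 : ℤ) : ℝ) ^ 2 * (∫ x, ‖beltramiField 1 (fun _ => 1) x‖ ^ 2) / 37 ^ 2)) ∧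
      Tendsto (fun j => meanDissipation (ν j) (u j)) atTop (𝓝 0) ∧
      (∀ j t, ∫ x, u j t x = !₂[(1 : ℝ), 10, 100]) :=
  exists_sweptFamily_beltrami one_ne_zero (fun _ _ => by simp) (by norm_num) freqDot_kvec_one_ge

end Summit.AnomalousDissipation.AnomalousDissipation.Theorems

end
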